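import Summits.CriticalPhenomena.SAWScalingLimit.Theorems.SAWDefectDecoherenceMassRatioFlatRootDefs
import Summits.CriticalPhenomena.SAWScalingLimit.Theorems.SAWDefectDecoherenceMassRatioSwapArcPositive
import Summits.CriticalPhenomena.SAWScalingLimit.Theorems.SAWDefectDecoherenceBoundaryClosureRIdentificationReciprocity

/-!
# Status of `stub_rootSwapArc` (line `flat-root-arc-swap`, crux stmt-CriticalPhenomena-8550): BLOCKED — reduction to the change-of-root primitive
1. Missing input (ONE Prop, tree name): `FlatRoot.RootSwap ε`, `∀ ε > 0` (…MassRatioFlatRootDefs) = SAW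
   boundary quasi-multiplicativity / change of root `M_K(a_δ)·Z(b_δ→a') ≤ Cδ^{-ε}·Z(a_δ→b_δ)·M_K(a')`,
   `a' ∈ S_δ`; canonical 4-point form `CrossRatioBoundAt` below. PROVED: `CrossRatioBound ⇒ RootSwap ⇒ stub`
   (registered signature verbatim: `stub_rootSwapArc_of_rootSwap`).
2. Sharpness, PROVED: modulo the TAME flat-piece Harnack `T = FlatArcHarnackAt` (both roots door edges of
   the rigid piece) the stub is EQUIVALENT to its wild core `W = WildRootReleaseAt ε` (wild root dominated
   by ONE arc root): `stub ⇒ W` (pigeonhole + `swapArcAllPositive`: every `a' ∈ S_δ` has `Z(b_δ→a') > 0`,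
   PROVED in the frame) and `W(ε₁) ∧ T(ε₂) ⇒ RootSwap(ε₁+ε₂) ⇒ stub`; if `a_δ ∈ S_δ` eventually then `W(0)`
   holds by reciprocity `Z(b→a) = Z(a→b)` (tree), so on such frames stub ⟸ T exactly.
3. Why tree/print cannot supply W or T: `δ^{-ε}`-sharp comparison of critical SAW masses from two ROOTS;
   bridges/Hammersley–Welsh (`HV.hSum_le_prod`) lose `exp(c/√δ)`, DCS identities (`…lemma2_holds`,
   `escape_ge`) sum from ONE root, no domain Markov/harmonic measure/RSW (barrier `SAWNotKineticallyGrown`),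
   endpoint surgery costs a polynomial factor PER step. No in-frame refutation: root corridors cancel exactly
   (`Negative.verts_eq_corridor`), `b`-side and `S_δ` rigid, truth predicted `O(1)`. Lit: FTS searchd rc75,
   OpenAlex/S2 429; vsearch + `lit read --grep` Madras–Slade 1993 (bridges/half-space walks only); analogues
   cross-field only (Masson arXiv:0806.0357 LERW, Nolin arXiv:0711.4948 percolation; DCS arXiv:1007.0575 §3).
-/

/-!
# Crux `SAWDefectDecoherence.MassRatio` (stmt-CriticalPhenomena-8550), line `flat-root-arc-swap` —
# stub `stub_rootSwapArc`: reduction to the change-of-root primitive and its wild/tame factorisation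

Reduction file (line lead `c1`, worker wave) for the registered stub `stub_rootSwapArc` = `RootSwapArc ε` for every `ε > 0`:
in the frame of the crux, `M_K(a_δ)·Z_{Λ_δ}(b_δ → S_δ) ≤ Cδ^{-ε}·Z_{Λ_δ}(a_δ → b_δ)·Σ_{a'∈S_δ} M_K(a')`
(notation of `…MassRatioFlatRootDefs`: `Z Λ r z = ‖F_{Λ,r,x_c,0}(z)‖`, `massK`, `swapArc`, `Frame`).
The stub is NOT proved (see the diagnosis above); this file proves the reduction around it:

* `RootSwapArcAt`, `RootSwapAt` — the frame-wise forms of the lead's `RootSwapArc`, `RootSwap`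
  (`rootSwapArc_iff`, `rootSwap_iff` are `Iff.rfl`);
* `CrossRatioBoundAt ε` — the canonical four-point cross-ratio bound (pointwise in `a' ∈ S_δ` and in
  the `K`-mid-edge `e`); `rootSwapAt_of_crossRatioBoundAt` (sum over `e`), `rootSwapArcAt_of_rootSwapAt`
  (sum over `a'`), `stub_rootSwapArc_of_rootSwap` (the registered signature, verbatim, from `RootSwap`);
* `WildRootReleaseAt ε` (W: the wild root `a_δ` is dominated by ONE arc root `a'` with
  `Z(b_δ → a') > 0`) and `FlatArcHarnackAt ε` (T: comparability of the `K`-vs-`b_δ` odds between two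
  door edges of the flat piece) with `rootSwapAt_of_release_of_harnack : W(ε₁) → T(ε₂) → RootSwap(ε₁+ε₂)`
  and the converse `wildRootReleaseAt_of_rootSwapArcAt : RootSwapArc(ε) → W(ε)` (pigeonhole over the
  finite nonempty arc, GIVEN positivity of every arc term — supplied unconditionally by
  `swapArcAllPositive` in the companion file `…FlatRootSwapArcAllPositive.lean`);
* `wildRootReleaseAt_zero_of_rootOnArc` — if `a_δ ∈ S_δ` eventually, W holds at `ε = 0` with `C = 1`
  (reciprocity `Z(b_δ → a_δ) = Z(a_δ → b_δ)`, tree theorem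
  `PickHalfPlane.Identification.hexParafermionicObservable_zero_symm`), hence on such frames the stub is
  exactly the tame Harnack T (`rootSwapArcAt_of_rootOnArc_of_harnack`);
* `rootSwap_of_wildRootRelease_of_flatArcHarnack` — the registered sub-goal (verbatim form of the
  factorisation `W ∧ T ⇒ RootSwap`).

Sources: line card `Cruxes/MassRatio/Lines/flat-root-arc-swap.md`; Duminil-Copin–Smirnov, Ann. of Math.
175 (2012) (arXiv:1007.0575) §1–3; Madras–Slade, *The Self-Avoiding Walk* (1993) §1.2, §3.1.
-/

noncomputable section

namespace Summit.CriticalPhenomena.SAWScalingLimit.Theorems.MassRatio.FlatRoot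

open Literature.Probability.LatticeModels Literature.Probability.RandomPlanarGeometry
open Literature.Probability.RandomPlanarGeometry.SAW
open Summit.CriticalPhenomena.SAWScalingLimit.Theorems.MassRatio.Negative
open Summit.CriticalPhenomena.SAWScalingLimit.Theorems.MassRatio.Renewal (Z)
open scoped Classical

namespace RootSwapArc

/-! ### Basic facts on the mass `Z` -/

/-- `Z ≥ 0`. [folklore] -/
theorem Z_nonneg (Λ : Finset HexVertex) (r z : Sym2 HexVertex) : 0 ≤ Z Λ r z := norm_nonneg _

/-- **Reciprocity** `Z_Λ(r → z) = Z_Λ(z → r)` for two mid-edges of the domain (reverse the walk;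
tree theorem `hexParafermionicObservable_zero_symm`). [folklore] -/
theorem Z_symm {Λ : Finset HexVertex} {r z : Sym2 HexVertex} (hr : r ∈ hexDomainMidEdges Λ)
    (hz : z ∈ hexDomainMidEdges Λ) : Z Λ r z = Z Λ z r := by
  unfold Z
  rw [PickHalfPlane.Identification.hexParafermionicObservable_zero_symm Λ r z hr hz]

/-- An exhibited walk makes the mass positive. [folklore] -/
theorem Z_pos_of_nonempty {Λ : Finset HexVertex} {r z : Sym2 HexVertex}
    (h : Nonempty (HexMidEdgeSAW Λ r z)) : 0 < Z Λ r z :=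
  ArcSwap.SwapArcPositive.norm_pos_of_nonempty h

/-- `M_K(r)` as a `Finset` sum. [folklore] -/
theorem massK_eq (Λ : Finset HexVertex) (r : Sym2 HexVertex) (δ : ℝ) (K : Set ℂ) :
    massK Λ r δ K = δ ^ 2 * ∑ e ∈ (midEdgesIn_finite Λ δ K).toFinset, Z Λ r e := by
  unfold massK
  rw [finsum_mem_eq_finite_toFinset_sum _ (midEdgesIn_finite Λ δ K)]

/-! ### Frame-wise predicates -/

/-- `RootSwapArc(ε)` for ONE datum `(D, ρ, Λ, m, a, b)` (the registered stub at one `ε`, one frame).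
[folklore] -/
def RootSwapArcAt (ε : ℝ) (D : DobrushinDomain) (ρ : ℝ) (Λ : ℝ → Finset HexVertex) (m : ℝ → ℤ)
    (a b : ℝ → Sym2 HexVertex) : Prop :=
  Frame D ρ Λ m a b → ∀ K : Set ℂ, IsCompact K → K ⊆ D.carrier → ∃ C : ℝ,
    ∀ᶠ δ : ℝ in nhdsWithin 0 (Set.Ioi 0),
      massK (Λ δ) (a δ) δ K * ∑ᶠ a' ∈ swapArc D ρ Λ δ, Z (Λ δ) (b δ) a' ≤
        C * δ ^ (-ε) * Z (Λ δ) (a δ) (b δ) * ∑ᶠ a' ∈ swapArc D ρ Λ δ, massK (Λ δ) a' δ K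

/-- `RootSwap(ε)` (pointwise in `a' ∈ S_δ`) for one datum. [folklore] -/
def RootSwapAt (ε : ℝ) (D : DobrushinDomain) (ρ : ℝ) (Λ : ℝ → Finset HexVertex) (m : ℝ → ℤ)
    (a b : ℝ → Sym2 HexVertex) : Prop :=
  Frame D ρ Λ m a b → ∀ K : Set ℂ, IsCompact K → K ⊆ D.carrier → ∃ C : ℝ,
    ∀ᶠ δ : ℝ in nhdsWithin 0 (Set.Ioi 0), ∀ a' ∈ swapArc D ρ Λ δ,
      massK (Λ δ) (a δ) δ K * Z (Λ δ) (b δ) a' ≤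
        C * δ ^ (-ε) * Z (Λ δ) (a δ) (b δ) * massK (Λ δ) a' δ K

/-- **The canonical missing primitive (four-point cross-ratio bound / boundary quasi-multiplicativity
with one wild root).** For one datum: for every compact `K ⊆ Ω` some `C` with, eventually, for all
`a' ∈ S_δ` and all mid-edges `e` of `Λ_δ` with `δ·mid e ∈ K`,
`Z(a_δ → e)·Z(b_δ → a') ≤ C δ^{-ε}·Z(a_δ → b_δ)·Z(a' → e)` (predicted with `ε = 0`). [folklore] -/
def CrossRatioBoundAt (ε : ℝ) (D : DobrushinDomain) (ρ : ℝ) (Λ : ℝ → Finset HexVertex) (m : ℝ → ℤ)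
    (a b : ℝ → Sym2 HexVertex) : Prop :=
  Frame D ρ Λ m a b → ∀ K : Set ℂ, IsCompact K → K ⊆ D.carrier → ∃ C : ℝ,
    ∀ᶠ δ : ℝ in nhdsWithin 0 (Set.Ioi 0), ∀ a' ∈ swapArc D ρ Λ δ,
      ∀ e ∈ {e : Sym2 HexVertex | e ∈ hexDomainMidEdges (Λ δ) ∧ (δ : ℂ) * hexMidpoint e ∈ K},
        Z (Λ δ) (a δ) e * Z (Λ δ) (b δ) a' ≤ C * δ ^ (-ε) * Z (Λ δ) (a δ) (b δ) * Z (Λ δ) a' e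

/-- **W — wild-root release** (the irreducible wild content of the stub): for every compact `K ⊆ Ω`
some `C` with, eventually, SOME arc root `a' ∈ S_δ` with `Z(b_δ → a') > 0` and
`M_K(a_δ)·Z(b_δ → a') ≤ C δ^{-ε}·Z(a_δ → b_δ)·M_K(a')`. [folklore] -/
def WildRootReleaseAt (ε : ℝ) (D : DobrushinDomain) (ρ : ℝ) (Λ : ℝ → Finset HexVertex) (m : ℝ → ℤ)
    (a b : ℝ → Sym2 HexVertex) : Prop :=
  Frame D ρ Λ m a b → ∀ K : Set ℂ, IsCompact K → K ⊆ D.carrier → ∃ C : ℝ,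
    ∀ᶠ δ : ℝ in nhdsWithin 0 (Set.Ioi 0), ∃ a' ∈ swapArc D ρ Λ δ, 0 < Z (Λ δ) (b δ) a' ∧
      massK (Λ δ) (a δ) δ K * Z (Λ δ) (b δ) a' ≤
        C * δ ^ (-ε) * Z (Λ δ) (a δ) (b δ) * massK (Λ δ) a' δ K

/-- **T — flat-arc Harnack** (tame: both roots are door edges of the rigid flat piece): for every
compact `K ⊆ Ω` some `C` with, eventually, for all `a₁, a₂ ∈ S_δ`,
`M_K(a₁)·Z(b_δ → a₂) ≤ C δ^{-ε}·Z(b_δ → a₁)·M_K(a₂)`. [folklore] -/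
def FlatArcHarnackAt (ε : ℝ) (D : DobrushinDomain) (ρ : ℝ) (Λ : ℝ → Finset HexVertex) (m : ℝ → ℤ)
    (a b : ℝ → Sym2 HexVertex) : Prop :=
  Frame D ρ Λ m a b → ∀ K : Set ℂ, IsCompact K → K ⊆ D.carrier → ∃ C : ℝ,
    ∀ᶠ δ : ℝ in nhdsWithin 0 (Set.Ioi 0), ∀ a₁ ∈ swapArc D ρ Λ δ, ∀ a₂ ∈ swapArc D ρ Λ δ,
      massK (Λ δ) a₁ δ K * Z (Λ δ) (b δ) a₂ ≤
        C * δ ^ (-ε) * Z (Λ δ) (b δ) a₁ * massK (Λ δ) a₂ δ K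

/-- Every arc root carries positive mass from `b_δ` (eventually): for one datum. [folklore] -/
def SwapArcAllPositive (D : DobrushinDomain) (ρ : ℝ) (Λ : ℝ → Finset HexVertex) (m : ℝ → ℤ)
    (a b : ℝ → Sym2 HexVertex) : Prop :=
  Frame D ρ Λ m a b → ∀ᶠ δ : ℝ in nhdsWithin 0 (Set.Ioi 0), ∀ a' ∈ swapArc D ρ Λ δ,
    0 < Z (Λ δ) (b δ) a'

/-- The lead's `RootSwapArc ε` is the conjunction of its frame-wise forms. [folklore] -/
theorem rootSwapArc_iff {ε : ℝ} :
    RootSwapArc ε ↔ ∀ (D : DobrushinDomain) (ρ : ℝ) (Λ : ℝ → Finset HexVertex) (m : ℝ → ℤ)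
      (a b : ℝ → Sym2 HexVertex), RootSwapArcAt ε D ρ Λ m a b := Iff.rfl

/-- The lead's `RootSwap ε` is the conjunction of its frame-wise forms. [folklore] -/
theorem rootSwap_iff {ε : ℝ} :
    RootSwap ε ↔ ∀ (D : DobrushinDomain) (ρ : ℝ) (Λ : ℝ → Finset HexVertex) (m : ℝ → ℤ)
      (a b : ℝ → Sym2 HexVertex), RootSwapAt ε D ρ Λ m a b := Iff.rfl

/-! ### The reduction `CrossRatioBound ⇒ RootSwap ⇒ RootSwapArc` -/

section Reduction

variable {ε : ℝ} {D : DobrushinDomain} {ρ : ℝ} {Λ : ℝ → Finset HexVertex} {m : ℝ → ℤ}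
  {a b : ℝ → Sym2 HexVertex}

/-- Summing the four-point bound over the `K`-mid-edges `e` (weight `δ²`) gives the pointwise root
swap. [folklore] -/
theorem rootSwapAt_of_crossRatioBoundAt (h : CrossRatioBoundAt ε D ρ Λ m a b) :
    RootSwapAt ε D ρ Λ m a b := by
  intro hF K hK hKD
  obtain ⟨C, hC⟩ := h hF K hK hKD
  refine ⟨C, hC.mono fun δ hδ a' ha' => ?_⟩
  have hE := midEdgesIn_finite (Λ δ) δ K
  rw [massK_eq, massK_eq]
  have key : ∀ e ∈ hE.toFinset, δ ^ 2 * (Z (Λ δ) (a δ) e * Z (Λ δ) (b δ) a') ≤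
      δ ^ 2 * (C * δ ^ (-ε) * Z (Λ δ) (a δ) (b δ) * Z (Λ δ) a' e) := fun e he =>
    mul_le_mul_of_nonneg_left (hδ a' ha' e (hE.mem_toFinset.1 he)) (sq_nonneg δ)
  calc δ ^ 2 * (∑ e ∈ hE.toFinset, Z (Λ δ) (a δ) e) * Z (Λ δ) (b δ) a'
      = ∑ e ∈ hE.toFinset, δ ^ 2 * (Z (Λ δ) (a δ) e * Z (Λ δ) (b δ) a') := by
        rw [Finset.mul_sum, Finset.sum_mul]
        exact Finset.sum_congr rfl fun e _ => by ring
    _ ≤ ∑ e ∈ hE.toFinset, δ ^ 2 * (C * δ ^ (-ε) * Z (Λ δ) (a δ) (b δ) * Z (Λ δ) a' e) :=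
        Finset.sum_le_sum key
    _ = C * δ ^ (-ε) * Z (Λ δ) (a δ) (b δ) * (δ ^ 2 * ∑ e ∈ hE.toFinset, Z (Λ δ) a' e) := by
        rw [Finset.mul_sum, Finset.mul_sum]
        exact Finset.sum_congr rfl fun e _ => by ring

/-- Summing the pointwise root swap over the finite arc `S_δ` gives the arc form (the stub).
[folklore] -/
theorem rootSwapArcAt_of_rootSwapAt (h : RootSwapAt ε D ρ Λ m a b) : RootSwapArcAt ε D ρ Λ m a b := by
  intro hF K hK hKD
  obtain ⟨C, hC⟩ := h hF K hK hKD
  refine ⟨C, hC.mono fun δ hδ => ?_⟩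
  have hfin := swapArc_finite D ρ Λ δ
  rw [finsum_mem_eq_finite_toFinset_sum _ hfin, finsum_mem_eq_finite_toFinset_sum _ hfin,
    Finset.mul_sum, Finset.mul_sum]
  exact Finset.sum_le_sum fun a' ha' => hδ a' (hfin.mem_toFinset.1 ha')

/-- `CrossRatioBound ⇒ RootSwapArc`, frame-wise. [folklore] -/
theorem rootSwapArcAt_of_crossRatioBoundAt (h : CrossRatioBoundAt ε D ρ Λ m a b) :
    RootSwapArcAt ε D ρ Λ m a b :=
  rootSwapArcAt_of_rootSwapAt (rootSwapAt_of_crossRatioBoundAt h)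

end Reduction

/-- **The registered stub from the missing primitive.** `RootSwap ε` for every `ε > 0` implies the
registered signature of `stub_rootSwapArc`, verbatim. [folklore] -/
theorem stub_rootSwapArc_of_rootSwap (hRS : ∀ ε : ℝ, 0 < ε → RootSwap ε) : ∀ ε : ℝ, 0 < ε →
    ∀ (D : DobrushinDomain) (ρ : ℝ) (Λ : ℝ → Finset HexVertex) (m : ℝ → ℤ)
      (a b : ℝ → Sym2 HexVertex),
      0 < ρ →
      D.carrier ∩ Metric.ball (D.pt 1) ρ = {z : ℂ | (D.pt 1).im < z.im} ∩ Metric.ball (D.pt 1) ρ →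
      (∀ᶠ δ : ℝ in nhdsWithin 0 (Set.Ioi 0),
        hexDomainSimplyConnected (Λ δ) ∧ a δ ∈ hexDomainBoundary (Λ δ) ∧
          b δ ∈ hexDomainBoundary (Λ δ) ∧ Nonempty (HexMidEdgeSAW (Λ δ) (a δ) (b δ)) ∧
          (hexGraph.induce ((Λ δ : Finset HexVertex) : Set HexVertex)).Preconnected ∧
          (∀ v ∈ Λ δ, (δ : ℂ) * hexCenter v ∈ D.carrier) ∧
          (∀ v : HexVertex, (δ : ℂ) * hexCenter v ∈ Metric.ball (D.pt 1) ρ →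
            (v ∈ Λ δ ↔ m δ ≤ v.1 1))) →
      (∀ K : Set ℂ, IsCompact K → K ⊆ D.carrier → ∀ᶠ δ : ℝ in nhdsWithin 0 (Set.Ioi 0),
        ∀ v : HexVertex, (δ : ℂ) * hexCenter v ∈ K → v ∈ Λ δ) →
      Filter.Tendsto (fun δ : ℝ => (δ : ℂ) * hexMidpoint (a δ)) (nhdsWithin 0 (Set.Ioi 0))
        (nhds (D.pt 0)) →
      Filter.Tendsto (fun δ : ℝ => (δ : ℂ) * hexMidpoint (b δ)) (nhdsWithin 0 (Set.Ioi 0))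
        (nhds (D.pt 1)) →
      ∀ K : Set ℂ, IsCompact K → K ⊆ D.carrier → ∃ C : ℝ,
        ∀ᶠ δ : ℝ in nhdsWithin 0 (Set.Ioi 0),
          (δ ^ 2 * ∑ᶠ e ∈ {e : Sym2 HexVertex | e ∈ hexDomainMidEdges (Λ δ) ∧
              (δ : ℂ) * hexMidpoint e ∈ K},
              ‖hexParafermionicObservable (Λ δ) (a δ) hexCriticalFugacity 0 e‖) *
            (∑ᶠ a' ∈ {e : Sym2 HexVertex | e ∈ hexDomainBoundary (Λ δ) ∧
              ρ / 4 ≤ dist ((δ : ℂ) * hexMidpoint e) (D.pt 1) ∧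
              dist ((δ : ℂ) * hexMidpoint e) (D.pt 1) ≤ ρ / 2},
              ‖hexParafermionicObservable (Λ δ) (b δ) hexCriticalFugacity 0 a'‖) ≤
          C * δ ^ (-ε) * ‖hexParafermionicObservable (Λ δ) (a δ) hexCriticalFugacity 0 (b δ)‖ *
            ∑ᶠ a' ∈ {e : Sym2 HexVertex | e ∈ hexDomainBoundary (Λ δ) ∧
              ρ / 4 ≤ dist ((δ : ℂ) * hexMidpoint e) (D.pt 1) ∧
              dist ((δ : ℂ) * hexMidpoint e) (D.pt 1) ≤ ρ / 2},
              (δ ^ 2 * ∑ᶠ e ∈ {e : Sym2 HexVertex | e ∈ hexDomainMidEdges (Λ δ) ∧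
                (δ : ℂ) * hexMidpoint e ∈ K},
                ‖hexParafermionicObservable (Λ δ) a' hexCriticalFugacity 0 e‖) := by
  intro ε hε D ρ Λ m a b hρ hflat hadm hexh ha hb K hK hKD
  exact rootSwapArcAt_of_rootSwapAt (hRS ε hε D ρ Λ m a b) ⟨hρ, hflat, hadm, hexh, ha, hb⟩ K hK hKD

/-! ### The wild/tame factorisation: `W ∧ T ⇒ RootSwap`, `RootSwapArc ⇒ W` -/

section WildTame

variable {ε ε₁ ε₂ : ℝ} {D : DobrushinDomain} {ρ : ℝ} {Λ : ℝ → Finset HexVertex} {m : ℝ → ℤ}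
  {a b : ℝ → Sym2 HexVertex}

/-- **`W(ε₁) ∧ T(ε₂) ⇒ RootSwap(ε₁ + ε₂)`.** Chain the release of the wild root onto one arc root
`a₀` with the Harnack comparison `a₀ ↝ a'` and cancel the positive mass `Z(b_δ → a₀)`. [folklore] -/
theorem rootSwapAt_of_release_of_harnack (hW : WildRootReleaseAt ε₁ D ρ Λ m a b)
    (hT : FlatArcHarnackAt ε₂ D ρ Λ m a b) : RootSwapAt (ε₁ + ε₂) D ρ Λ m a b := by
  intro hF K hK hKD
  obtain ⟨C₁, h₁⟩ := hW hF K hK hKD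
  obtain ⟨C₂, h₂⟩ := hT hF K hK hKD
  have h₀ : ∀ᶠ δ : ℝ in nhdsWithin 0 (Set.Ioi 0), 0 < δ := eventually_mem_nhdsWithin
  refine ⟨max C₁ 0 * max C₂ 0, ?_⟩
  filter_upwards [h₀, h₁, h₂] with δ hδ hδ₁ hδ₂
  intro a' ha'
  obtain ⟨a₀, ha₀, hpos, hW₀⟩ := hδ₁
  have hT₀ := hδ₂ a₀ ha₀ a' ha'
  set MA := massK (Λ δ) (a δ) δ K with hMA_def
  set M₀ := massK (Λ δ) a₀ δ K with hM₀_def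
  set M' := massK (Λ δ) a' δ K with hM'_def
  set Zab := Z (Λ δ) (a δ) (b δ) with hZab_def
  set Z₀ := Z (Λ δ) (b δ) a₀ with hZ₀_def
  set Z' := Z (Λ δ) (b δ) a' with hZ'_def
  have hM₀ : 0 ≤ M₀ := massK_nonneg _ _ _ _
  have hM' : 0 ≤ M' := massK_nonneg _ _ _ _
  have hZab : 0 ≤ Zab := Z_nonneg _ _ _
  have hZ' : 0 ≤ Z' := Z_nonneg _ _ _
  have hZ₀ : 0 ≤ Z₀ := hpos.le
  have hε₁ : 0 ≤ δ ^ (-ε₁) := Real.rpow_nonneg hδ.le _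
  have hε₂ : 0 ≤ δ ^ (-ε₂) := Real.rpow_nonneg hδ.le _
  have hexp : δ ^ (-ε₁) * δ ^ (-ε₂) = δ ^ (-(ε₁ + ε₂)) := by
    rw [← Real.rpow_add hδ]; congr 1; ring
  -- the two hypotheses with nonnegative constants
  have sW : MA * Z₀ ≤ max C₁ 0 * δ ^ (-ε₁) * Zab * M₀ := by
    refine hW₀.trans ?_
    have hx : 0 ≤ δ ^ (-ε₁) * Zab * M₀ := mul_nonneg (mul_nonneg hε₁ hZab) hM₀
    calc C₁ * δ ^ (-ε₁) * Zab * M₀ = C₁ * (δ ^ (-ε₁) * Zab * M₀) := by ring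
      _ ≤ max C₁ 0 * (δ ^ (-ε₁) * Zab * M₀) := mul_le_mul_of_nonneg_right (le_max_left _ _) hx
      _ = max C₁ 0 * δ ^ (-ε₁) * Zab * M₀ := by ring
  have sT : M₀ * Z' ≤ max C₂ 0 * δ ^ (-ε₂) * Z₀ * M' := by
    refine hT₀.trans ?_
    have hx : 0 ≤ δ ^ (-ε₂) * Z₀ * M' := mul_nonneg (mul_nonneg hε₂ hZ₀) hM'
    calc C₂ * δ ^ (-ε₂) * Z₀ * M' = C₂ * (δ ^ (-ε₂) * Z₀ * M') := by ring
      _ ≤ max C₂ 0 * (δ ^ (-ε₂) * Z₀ * M') := mul_le_mul_of_nonneg_right (le_max_left _ _) hx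
      _ = max C₂ 0 * δ ^ (-ε₂) * Z₀ * M' := by ring
  have comb : MA * Z' * Z₀ ≤ (max C₁ 0 * max C₂ 0 * δ ^ (-(ε₁ + ε₂)) * Zab * M') * Z₀ := by
    calc MA * Z' * Z₀ = (MA * Z₀) * Z' := by ring
      _ ≤ (max C₁ 0 * δ ^ (-ε₁) * Zab * M₀) * Z' := mul_le_mul_of_nonneg_right sW hZ'
      _ = max C₁ 0 * δ ^ (-ε₁) * Zab * (M₀ * Z') := by ring
      _ ≤ max C₁ 0 * δ ^ (-ε₁) * Zab * (max C₂ 0 * δ ^ (-ε₂) * Z₀ * M') :=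
          mul_le_mul_of_nonneg_left sT (mul_nonneg (mul_nonneg (le_max_right _ _) hε₁) hZab)
      _ = (max C₁ 0 * max C₂ 0 * (δ ^ (-ε₁) * δ ^ (-ε₂)) * Zab * M') * Z₀ := by ring
      _ = (max C₁ 0 * max C₂ 0 * δ ^ (-(ε₁ + ε₂)) * Zab * M') * Z₀ := by rw [hexp]
  exact le_of_mul_le_mul_right comb hpos

/-- **`RootSwapArc(ε) ⇒ W(ε)`** (pigeonhole over the finite, eventually nonempty arc, all of whose
terms are positive): the registered arc form already contains the wild-root release. Nonemptiness of
`S_δ` is the landed `ArcSwap.stub_swapArcPositive`. [folklore] -/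
theorem wildRootReleaseAt_of_rootSwapArcAt (h : RootSwapArcAt ε D ρ Λ m a b)
    (hpos : SwapArcAllPositive D ρ Λ m a b) : WildRootReleaseAt ε D ρ Λ m a b := by
  intro hF K hK hKD
  obtain ⟨C, hC⟩ := h hF K hK hKD
  have hposF := hpos hF
  obtain ⟨hρ, hflat, hadm, hexh, ha, hb⟩ := hF
  have hne := ArcSwap.stub_swapArcPositive D ρ Λ m a b hρ hflat hadm hexh ha hb
  refine ⟨C, ?_⟩
  filter_upwards [hC, hposF, hne] with δ hδ hposδ hneδ
  change 0 < ∑ᶠ a' ∈ swapArc D ρ Λ δ, Z (Λ δ) (b δ) a' at hneδ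
  have hfin := swapArc_finite D ρ Λ δ
  by_contra hcon
  push Not at hcon
  have hS : hfin.toFinset.Nonempty := by
    by_contra hemp
    rw [Finset.not_nonempty_iff_eq_empty] at hemp
    have h0 : ∑ᶠ a' ∈ swapArc D ρ Λ δ, Z (Λ δ) (b δ) a' = 0 := by
      rw [finsum_mem_eq_finite_toFinset_sum _ hfin, hemp, Finset.sum_empty]
    exact absurd h0 (ne_of_gt hneδ)
  have hlt : ∀ a' ∈ hfin.toFinset,
      C * δ ^ (-ε) * Z (Λ δ) (a δ) (b δ) * massK (Λ δ) a' δ K <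
        massK (Λ δ) (a δ) δ K * Z (Λ δ) (b δ) a' := fun a' ha' => by
    have ha'S := hfin.mem_toFinset.1 ha'
    exact hcon a' ha'S (hposδ a' ha'S)
  have hsum := Finset.sum_lt_sum_of_nonempty hS hlt
  rw [finsum_mem_eq_finite_toFinset_sum _ hfin, finsum_mem_eq_finite_toFinset_sum _ hfin,
    Finset.mul_sum, Finset.mul_sum] at hδ
  exact absurd hδ (not_le.2 hsum)

/-- **Root on the arc ⇒ `W(0)` with `C = 1`**, by reciprocity `Z(b_δ → a_δ) = Z(a_δ → b_δ)` (both are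
boundary mid-edges) and `Z(a_δ → b_δ) > 0` (the frame's `Nonempty` clause). [folklore] -/
theorem wildRootReleaseAt_zero_of_rootOnArc
    (harc : ∀ᶠ δ : ℝ in nhdsWithin 0 (Set.Ioi 0), a δ ∈ swapArc D ρ Λ δ) :
    WildRootReleaseAt 0 D ρ Λ m a b := by
  intro hF K _hK _hKD
  obtain ⟨-, -, hadm, -, -, -⟩ := hF
  refine ⟨1, ?_⟩
  filter_upwards [harc, hadm] with δ hδ hA
  obtain ⟨-, haB, hbB, hne, -, -, -⟩ := hA
  have haM : a δ ∈ hexDomainMidEdges (Λ δ) := hexDomainBoundary_subset _ haB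
  have hbM : b δ ∈ hexDomainMidEdges (Λ δ) := hexDomainBoundary_subset _ hbB
  have hsymm : Z (Λ δ) (b δ) (a δ) = Z (Λ δ) (a δ) (b δ) := Z_symm hbM haM
  refine ⟨a δ, hδ, ?_, ?_⟩
  · rw [hsymm]; exact Z_pos_of_nonempty hne
  · rw [hsymm, neg_zero, Real.rpow_zero, mul_one, one_mul]
    exact le_of_eq (mul_comm _ _)

/-- Hence, when the root lies on the arc eventually, the stub for that datum is exactly the tame
Harnack `T(ε)`. [folklore] -/
theorem rootSwapArcAt_of_rootOnArc_of_harnack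
    (harc : ∀ᶠ δ : ℝ in nhdsWithin 0 (Set.Ioi 0), a δ ∈ swapArc D ρ Λ δ)
    (hT : FlatArcHarnackAt ε D ρ Λ m a b) : RootSwapArcAt ε D ρ Λ m a b := by
  have h := rootSwapAt_of_release_of_harnack (wildRootReleaseAt_zero_of_rootOnArc harc) hT
  rw [zero_add] at h
  exact rootSwapArcAt_of_rootSwapAt h

end WildTame

/-- Global corollary: W and T for every datum give the lead's pointwise `RootSwap`, hence the stub
(`stub_rootSwapArc_of_rootSwap`). [folklore] -/
theorem rootSwap_of_release_of_harnack {ε₁ ε₂ : ℝ}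
    (hW : ∀ (D : DobrushinDomain) (ρ : ℝ) (Λ : ℝ → Finset HexVertex) (m : ℝ → ℤ)
      (a b : ℝ → Sym2 HexVertex), WildRootReleaseAt ε₁ D ρ Λ m a b)
    (hT : ∀ (D : DobrushinDomain) (ρ : ℝ) (Λ : ℝ → Finset HexVertex) (m : ℝ → ℤ)
      (a b : ℝ → Sym2 HexVertex), FlatArcHarnackAt ε₂ D ρ Λ m a b) :
    RootSwap (ε₁ + ε₂) :=
  fun D ρ Λ m a b => rootSwapAt_of_release_of_harnack (hW D ρ Λ m a b) (hT D ρ Λ m a b)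

/-- **Registered sub-goal (verbatim form): the wild/tame factorisation of the change of root** —
`WildRootRelease(ε₁)` at every datum and the flat-arc Harnack `FlatArcHarnack(ε₂)` at every datum give
the pointwise root swap `RootSwap (ε₁ + ε₂)` (hence `RootSwapArc`, by the landed glue). -/
theorem rootSwap_of_wildRootRelease_of_flatArcHarnack : ∀ ε₁ ε₂ : ℝ, (∀ (D : DobrushinDomain) (ρ : ℝ) (Λ : ℝ → Finset HexVertex) (m : ℝ → ℤ) (a b : ℝ → Sym2 HexVertex), WildRootReleaseAt ε₁ D ρ Λ m a b) → (∀ (D : DobrushinDomain) (ρ : ℝ) (Λ : ℝ → Finset HexVertex) (m : ℝ → ℤ) (a b : ℝ → Sym2 HexVertex), FlatArcHarnackAt ε₂ D ρ Λ m a b) → RootSwap (ε₁ + ε₂) := by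
  intro ε₁ ε₂ hW hT
  exact rootSwap_of_release_of_harnack hW hT

end RootSwapArc

end Summit.CriticalPhenomena.SAWScalingLimit.Theorems.MassRatio.FlatRoot
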